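import Literature.MathematicalPhysics.QuantumLattice.HubbardSliceSymbolSmoothMomentum
import Literature.MathematicalPhysics.QuantumLattice.HubbardGridCharacters
import Literature.MathematicalPhysics.QuantumLattice.HubbardGridSliceGram
import Literature.Analysis.Calculus.SecondDifferenceBound
import HarnessLib

/-!
# Second differences of the padded slice symbol on the space–time dual torus `(ℤ/N) × (ℤ/L)²`

Topic `MathematicalPhysics/QuantumLattice`; the lattice side of R0-SCOPE-4 W2c (cell gate-hubbard-kl).  The symbol of the shifted Salmhofer
slice `C^θ_{(Λ,Λ′]}` padded to the product torus (`HubbardGridCharacters.gridSymbol`, `2M ≤ N`) is the restriction of the `C²` functions of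
`HubbardSliceSymbolSmooth(Momentum)`: in the time direction at the equally spaced frequencies `ω̃_v = π(2v-2M+1)/β` (`gridSymbol_shiftedSlice_eq`;
the padding values are genuine values of the continuum function, which vanishes beyond `Λ′ < π(2M-3)/β`), in each space direction at the
momenta `p_i + m·2π/L`.  Hence (mean value inequality twice, `SecondDifferenceBound`) its second forward differences are bounded by
`(βL²)⁻²·(2π/β)²·K βL²/Λ³` (time) and `(βL²)⁻²·(2π/L)²·K′ βL²/Λ³` (space), and they are supported in (three translates of) the shell
`{|ω| ≤ Λ′} × {|ξ| < Λ′}`; summing the squares gives the `ℓ²` inputs of the weighted Plancherel bound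
`TorusFourierWeightedL1Prod.sum_sum_norm_prodChar_le` with `N = 2` (Benfatto–Giuliani–Mastropietro 2006, (2.36aa) and footnote ¹ at finite
`(β, L)`):

* `shiftedSliceSymbol`, `gridFreq`; `gridSymbol_shiftedSlice_eq` — `G(q₀,q⃗) = (βL²)⁻² Ψ_{ξ(q⃗)}(ω̃_{q₀})` for ALL `q₀`;
* `fwdDiff_iter_two_apply`, `exists_ne_zero_of_fwdDiff_iter_two_ne_zero`, `sum_sum_norm_sq_le_of_support` — bookkeeping;
* **`norm_fwdDiff_two_time_gridSymbol_le`**, **`norm_fwdDiff_two_space_gridSymbol_le`** — the pointwise bounds;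
* `card_freqWindow_le`, `gridSymbol_ne_zero_mem` — the support;
* **`sum_norm_sq_gridSymbol_shiftedSlice_le`**, **`sum_norm_sq_fwdDiff_two_time_le`**, **`sum_norm_sq_fwdDiff_two_space_le`** — the `ℓ²` sums.

Everything is proved; `shiftedSliceSymbol` and `gridFreq` are the only definitions; no named facts.

## Sources

G. Benfatto, A. Giuliani, V. Mastropietro, Ann. Henri Poincaré 7 (2006) 809–898, Lemma 2.2, (2.36aa) and footnote ¹
(`BenfattoGiulianiMastropietro2006`); M. Salmhofer, *Renormalization* (1999), §4.2.5 (4.70)–(4.71) (`Salmhofer1999`).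
-/

noncomputable section

namespace Literature.MathematicalPhysics.QuantumLattice

open Literature.Probability.LatticeModels Finset Complex

variable {L M N : ℕ}

/-! ### The symbol and the padded frequencies -/

variable (L M) in
/-- The **symbol of the shifted Salmhofer slice** `(w_Λ(k) - w_{Λ′}(k))·p_θ(k,σ)` (`hubbardCovSliceShifted = normalCovariance` of it).
[cite: Salmhofer1999, §4.2.5 (4.70)] -/
def shiftedSliceSymbol (β μ θ Λ Λ' : ℝ) (ks : FreqMomentum L M × Fin 2) : ℂ :=
  ((hubbardCutoffWeight L M β μ Λ ks.1 : ℂ) - (hubbardCutoffWeight L M β μ Λ' ks.1 : ℂ)) * shiftedFreeSymbol L M β μ θ ks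

/-- `hubbardCovSliceShifted` is the normal covariance of `shiftedSliceSymbol`. [cite: Salmhofer1999, §4.2.5 (4.70)] -/
theorem hubbardCovSliceShifted_eq_normalCovariance (β μ θ Λ Λ' : ℝ) :
    hubbardCovSliceShifted L M β μ θ Λ Λ' = normalCovariance L M (shiftedSliceSymbol L M β μ θ Λ Λ') := rfl

variable (M N) in
/-- The **padded frequency** of a point of the time dual torus: `ω̃_{q₀} = π(2 val(q₀) - 2M + 1)/β` (the Matsubara frequency of the
index `val q₀` when `val q₀ < 2M`, continued arithmetically beyond). [cite: Salmhofer1999, §4.2.4 (4.63)] -/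
def gridFreq (β : ℝ) (q₀ : TorusSite 1 N) : ℝ := Real.pi * (2 * ((q₀ 0).val : ℝ) - 2 * M + 1) / β

/-- For an index below `2M` the padded frequency is the Matsubara frequency. [cite: Salmhofer1999, §4.2.4 (4.63)] -/
theorem matsubaraFreq_eq_gridFreq (β : ℝ) (q₀ : TorusSite 1 N) (h : (q₀ 0).val < 2 * M) :
    matsubaraFreq β M ⟨(q₀ 0).val, h⟩ = gridFreq M N β q₀ := by
  simp only [matsubaraFreq, matsubaraInt, gridFreq]
  push_cast
  ring

section Slice

variable [NeZero L] [NeZero N] {β μ θ Λ Λ' : ℝ}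

/-- The continuum symbol vanishes at frequencies beyond `Λ′`. [cite: Salmhofer1999, §4.2.5 (4.71)] -/
theorem sliceSymbolFn_eq_zero_of_lt (hΛ : 0 < Λ) (hΛΛ' : Λ ≤ Λ') (c : ℝ) (ξ : ℝ) {ω : ℝ} (hω : Λ' < |ω|) :
    sliceSymbolFn c θ Λ Λ' ξ ω = 0 := by
  have h : Λ' ^ 2 < ω ^ 2 + ξ ^ 2 := by
    have hΛ' : 0 < Λ' := hΛ.trans_le hΛΛ'
    have := sq_lt_sq' (by linarith [abs_nonneg ω]) hω
    rw [sq_abs] at this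
    nlinarith [sq_nonneg ξ]
  rw [sliceSymbolFn, (sliceWeightFn_eq_zero_of_not_mem hΛ hΛΛ' (Or.inr h)).1, Complex.ofReal_zero, zero_mul]

omit [NeZero N] in
/-- **The padded slice symbol is the restriction of the continuum symbol at ALL points of the time dual torus**: for `0 < β`,
`|βθ| ≤ π/4`, `0 < Λ ≤ Λ′ < π(2M+1)/β`,
`G_σ(q₀, q⃗) = (βL²)⁻² · Ψ_{ξ(q⃗)}(ω̃_{q₀})` (the padding zeros are values of `Ψ` beyond `Λ′`). [cite: BenfattoGiulianiMastropietro2006, §2.1 (2.3)] -/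
theorem gridSymbol_shiftedSlice_eq (hβ : 0 < β) (hθ : |β * θ| ≤ Real.pi / 4) (hΛ : 0 < Λ) (hΛΛ' : Λ ≤ Λ')
    (hM : Λ' < Real.pi * (2 * M + 1) / β) (σ : Fin 2) (q₀ : TorusSite 1 N) (qv : TorusSite 2 L) :
    gridSymbol L M N β (shiftedSliceSymbol L M β μ θ Λ Λ') σ q₀ qv =
      ((1 / (β * (L : ℝ) ^ 2) : ℝ) : ℂ) ^ 2 * sliceSymbolFn (β * (L : ℝ) ^ 2) θ Λ Λ' (nambuXi L μ qv) (gridFreq M N β q₀) := by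
  unfold gridSymbol
  split_ifs with h
  · rw [shiftedSliceSymbol, sliceSymbol_eq_sliceSymbolFn hβ μ hθ, matsubaraFreq_eq_gridFreq β q₀ h]
  · symm
    rw [sliceSymbolFn_eq_zero_of_lt (θ := θ) hΛ hΛΛ' _ _ ?_, mul_zero]
    rw [not_lt] at h
    have hv : (2 * M : ℝ) ≤ ((q₀ 0).val : ℝ) := by exact_mod_cast h
    have hpos : 0 < gridFreq M N β q₀ := by
      unfold gridFreq
      exact div_pos (mul_pos Real.pi_pos (by linarith)) hβ
    rw [abs_of_pos hpos, gridFreq]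
    refine hM.trans_le (div_le_div_of_nonneg_right ?_ hβ.le)
    nlinarith [Real.pi_pos]

end Slice

/-! ### Bookkeeping: second differences, supports, sums of squares -/

/-- `(Δ_w)² g (x) = g(x + 2w) - 2 g(x + w) + g(x)` in an additive commutative group. [cite: BenfattoGiulianiMastropietro2006, (2.36aa)] -/
theorem fwdDiff_iter_two_apply {A E : Type*} [AddCommMonoid A] [AddCommGroup E] (w : A) (g : A → E) (x : A) :
    (fwdDiff w)^[2] g x = g (x + 2 • w) - (2 : ℤ) • g (x + 1 • w) + g x := by
  simp only [Function.iterate_succ_apply', Function.iterate_zero_apply, fwdDiff, two_nsmul, one_nsmul, ← add_assoc]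
  abel

/-- If a second difference is nonzero, the function is nonzero at one of the three points. [cite: BenfattoGiulianiMastropietro2006, (2.36aa)] -/
theorem exists_ne_zero_of_fwdDiff_iter_two_ne_zero {A E : Type*} [AddCommMonoid A] [AddCommGroup E] (w : A) (g : A → E) (x : A)
    (h : (fwdDiff w)^[2] g x ≠ 0) : ∃ j : ℕ, j < 3 ∧ g (x + j • w) ≠ 0 := by
  by_contra hall
  simp only [not_exists, not_and, not_not] at hall
  apply h
  rw [fwdDiff_iter_two_apply, hall 2 (by norm_num), hall 1 (by norm_num)]
  have h0 := hall 0 (by norm_num)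
  rw [zero_nsmul, add_zero] at h0
  rw [h0]
  simp

/-- **Sums of squares over a support**: if `F` vanishes off `T × S` and `‖F‖ ≤ B`, then `Σ_{a,b} ‖F a b‖² ≤ #T · #S · B²`.
[cite: BenfattoGiulianiMastropietro2006, §2.8 (2.80)] -/
theorem sum_sum_norm_sq_le_of_support {α γ E : Type*} [Fintype α] [Fintype γ] [DecidableEq α] [DecidableEq γ]
    [SeminormedAddCommGroup E] (F : α → γ → E) (T : Finset α) (S : Finset γ)
    (hsupp : ∀ a b, F a b ≠ 0 → a ∈ T ∧ b ∈ S) {B : ℝ} (hB : ∀ a b, ‖F a b‖ ≤ B) :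
    ∑ a, ∑ b, ‖F a b‖ ^ 2 ≤ T.card * S.card * B ^ 2 := by
  have hzero : ∀ a b, ¬(a ∈ T ∧ b ∈ S) → ‖F a b‖ ^ 2 = 0 := by
    intro a b hab
    rw [show F a b = 0 from not_not.1 fun h => hab (hsupp a b h), norm_zero, zero_pow two_ne_zero]
  have hinner : ∀ a, ∑ b, ‖F a b‖ ^ 2 = ∑ b ∈ S, ‖F a b‖ ^ 2 := fun a =>
    (sum_subset (subset_univ S) fun b _ hb => hzero a b fun h => hb h.2).symm
  have houter : ∑ a, ∑ b ∈ S, ‖F a b‖ ^ 2 = ∑ a ∈ T, ∑ b ∈ S, ‖F a b‖ ^ 2 :=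
    (sum_subset (subset_univ T) fun a _ ha => sum_eq_zero fun b _ => hzero a b fun h => ha h.1).symm
  simp_rw [hinner]
  rw [houter]
  calc ∑ a ∈ T, ∑ b ∈ S, ‖F a b‖ ^ 2 ≤ ∑ _a ∈ T, ∑ _b ∈ S, B ^ 2 :=
        sum_le_sum fun a _ => sum_le_sum fun b _ => pow_le_pow_left₀ (norm_nonneg _) (hB a b) 2
    _ = T.card * S.card * B ^ 2 := by rw [sum_const, sum_const, smul_smul, nsmul_eq_mul, Nat.cast_mul]

/-! ### The time direction -/

section Time

variable [NeZero L] [NeZero N] {β μ θ Λ Λ' : ℝ}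

omit [NeZero L] [NeZero N] in
/-- The time step: `(m • 1)(0) = m` in `ℤ/N`. [cite: Salmhofer1999, §4.2.4 (4.63)] -/
theorem smul_const_one_apply (m : ℕ) : (m • (fun _ : Fin 1 => (1 : ZMod N))) 0 = (m : ZMod N) := by
  simp

omit [NeZero L] in
/-- The padded frequency of a translate: `ω̃_{q₀ + m·1} = ω̃_{q₀} + m·2π/β` unless the index wraps, i.e. when `val q₀ + m < N`.
[cite: Salmhofer1999, §4.2.4 (4.63)] -/
theorem gridFreq_add_smul (β : ℝ) (q₀ : TorusSite 1 N) (m : ℕ) (h : (q₀ 0).val + m < N) :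
    gridFreq M N β (q₀ + m • (fun _ : Fin 1 => (1 : ZMod N))) = gridFreq M N β q₀ + m * (2 * Real.pi / β) := by
  have hval : ((q₀ + m • (fun _ : Fin 1 => (1 : ZMod N))) 0).val = (q₀ 0).val + m := by
    rw [Pi.add_apply, smul_const_one_apply, ZMod.val_add, ZMod.val_natCast, Nat.add_mod_mod, Nat.mod_eq_of_lt h]
  simp only [gridFreq, hval]
  push_cast
  ring

omit [NeZero L] [NeZero N] in
/-- Beyond `π(2M-3)/β` in absolute value the padded frequencies of the indices `≤ 1` and `≥ 2M-2` lie; there the continuum symbol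
vanishes when `Λ′ < π(2M-3)/β`. [cite: Salmhofer1999, §4.2.5 (4.71)] -/
theorem abs_gridFreq_ge (hβ : 0 < β) (q₀ : TorusSite 1 N) (h : (q₀ 0).val ≤ 1 ∨ 2 * M - 2 ≤ (q₀ 0).val) :
    Real.pi * (2 * M - 3) / β ≤ |gridFreq M N β q₀| := by
  unfold gridFreq
  rw [abs_div, abs_of_pos hβ, abs_mul, abs_of_pos Real.pi_pos]
  refine div_le_div_of_nonneg_right (mul_le_mul_of_nonneg_left ?_ Real.pi_pos.le) hβ.le
  rcases h with h | h
  · have hv : ((q₀ 0).val : ℝ) ≤ 1 := by exact_mod_cast h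
    rw [le_abs]
    right
    linarith
  · have hv : (2 * M : ℝ) - 2 ≤ ((q₀ 0).val : ℝ) := by
      have : 2 * M - 2 ≤ (q₀ 0).val := h
      have h' : 2 * M ≤ (q₀ 0).val + 2 := by omega
      have h'' : ((2 * M : ℕ) : ℝ) ≤ (((q₀ 0).val + 2 : ℕ) : ℝ) := by exact_mod_cast h'
      push_cast at h''
      linarith
    rw [le_abs]
    left
    linarith

/-- **The second time difference of the padded symbol is the second difference of the continuum symbol** at step `2π/β`:
for `0 < β`, `|βθ| ≤ π/4`, `0 < Λ ≤ Λ′ < π(2M-3)/β`, `2M ≤ N`, `2 ≤ M`,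
`(Δ_u)² G(·, q⃗)(q₀) = (βL²)⁻² [Ψ(ω̃+2δ) - 2Ψ(ω̃+δ) + Ψ(ω̃)]`, `u = 1`, `δ = 2π/β`, `ω̃ = ω̃_{q₀}`.
[cite: BenfattoGiulianiMastropietro2006, (2.36aa)] -/
theorem fwdDiff_two_time_gridSymbol_eq (hβ : 0 < β) (hθ : |β * θ| ≤ Real.pi / 4) (hΛ : 0 < Λ) (hΛΛ' : Λ ≤ Λ')
    (hM : Λ' < Real.pi * (2 * M - 3) / β) (hMN : 2 * M ≤ N) (hM2 : 2 ≤ M) (σ : Fin 2) (q₀ : TorusSite 1 N) (qv : TorusSite 2 L) :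
    (fwdDiff (fun _ : Fin 1 => (1 : ZMod N)))^[2] (fun q => gridSymbol L M N β (shiftedSliceSymbol L M β μ θ Λ Λ') σ q qv) q₀ =
      ((1 / (β * (L : ℝ) ^ 2) : ℝ) : ℂ) ^ 2 *
        (sliceSymbolFn (β * (L : ℝ) ^ 2) θ Λ Λ' (nambuXi L μ qv) (gridFreq M N β q₀ + 2 * (2 * Real.pi / β)) -
          (2 : ℝ) • sliceSymbolFn (β * (L : ℝ) ^ 2) θ Λ Λ' (nambuXi L μ qv) (gridFreq M N β q₀ + 2 * Real.pi / β) +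
          sliceSymbolFn (β * (L : ℝ) ^ 2) θ Λ Λ' (nambuXi L μ qv) (gridFreq M N β q₀)) := by
  have hM' : Λ' < Real.pi * (2 * M + 1) / β :=
    hM.trans_le (div_le_div_of_nonneg_right (mul_le_mul_of_nonneg_left (by linarith) Real.pi_pos.le) hβ.le)
  set Ψ := sliceSymbolFn (β * (L : ℝ) ^ 2) θ Λ Λ' (nambuXi L μ qv) with hΨ
  set u : TorusSite 1 N := fun _ => (1 : ZMod N) with hu
  have hG : ∀ q, gridSymbol L M N β (shiftedSliceSymbol L M β μ θ Λ Λ') σ q qv =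
      ((1 / (β * (L : ℝ) ^ 2) : ℝ) : ℂ) ^ 2 * Ψ (gridFreq M N β q) :=
    fun q => gridSymbol_shiftedSlice_eq hβ hθ hΛ hΛΛ' hM' σ q qv
  -- the continuum symbol vanishes at the far frequencies
  have hfar : ∀ ω : ℝ, Real.pi * (2 * M - 3) / β ≤ |ω| → Ψ ω = 0 := fun ω hω =>
    sliceSymbolFn_eq_zero_of_lt (θ := θ) hΛ hΛΛ' _ _ (hM.trans_le hω)
  rw [fwdDiff_iter_two_apply]
  simp only [hG]
  by_cases hwrap : (q₀ 0).val + 2 < N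
  · rw [gridFreq_add_smul β q₀ 2 hwrap, gridFreq_add_smul β q₀ 1 (by omega)]
    push_cast
    simp only [one_mul, zsmul_eq_mul, Int.cast_ofNat]
    rw [Complex.real_smul]
    push_cast
    ring
  · -- near the wrap: every value vanishes (indices `≥ 2M - 2` before wrapping, `≤ 1` after)
    have hv : N ≤ (q₀ 0).val + 2 := not_lt.1 hwrap
    have hvlt : (q₀ 0).val < N := ZMod.val_lt _
    have hz : ∀ m : ℕ, m ≤ 2 → Ψ (gridFreq M N β (q₀ + m • u)) = 0 := by
      intro m hm
      refine hfar _ (abs_gridFreq_ge (M := M) hβ _ ?_)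
      have hval : ((q₀ + m • u) 0).val = ((q₀ 0).val + m) % N := by
        rw [hu, Pi.add_apply, smul_const_one_apply, ZMod.val_add, ZMod.val_natCast, Nat.add_mod_mod]
      rw [hval]
      by_cases hlt : (q₀ 0).val + m < N
      · right; rw [Nat.mod_eq_of_lt hlt]; omega
      · left
        have hNpos : 0 < N := by omega
        have : (q₀ 0).val + m - N < N := by omega
        rw [show (q₀ 0).val + m = ((q₀ 0).val + m - N) + N by omega, Nat.add_mod_right, Nat.mod_eq_of_lt this]
        omega
    have hz0 : Ψ (gridFreq M N β q₀) = 0 := by simpa using hz 0 (by norm_num)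
    have hzω : ∀ j : ℕ, Ψ (gridFreq M N β q₀ + j * (2 * Real.pi / β)) = 0 := by
      intro j
      refine hfar _ ?_
      have h0 := abs_gridFreq_ge (M := M) hβ q₀ (Or.inr (by omega))
      have hM2r : (2 : ℝ) ≤ M := by exact_mod_cast hM2
      have hv2 : (2 * M : ℝ) - 2 ≤ ((q₀ 0).val : ℝ) := by
        have h' : 2 * M ≤ (q₀ 0).val + 2 := by omega
        have h'' : ((2 * M : ℕ) : ℝ) ≤ (((q₀ 0).val + 2 : ℕ) : ℝ) := by exact_mod_cast h'
        push_cast at h''; linarith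
      have hpos : 0 < gridFreq M N β q₀ := by
        unfold gridFreq; exact div_pos (mul_pos Real.pi_pos (by linarith)) hβ
      rw [abs_of_pos hpos] at h0
      rw [abs_of_pos (by positivity)]
      linarith [mul_nonneg (Nat.cast_nonneg j) (by positivity : (0 : ℝ) ≤ 2 * Real.pi / β)]
    rw [hz 2 (le_refl _), hz 1 (by norm_num), hz0]
    have h2 := hzω 2
    have h1 := hzω 1
    push_cast at h1 h2
    rw [one_mul] at h1
    rw [h2, h1]
    simp

end Time

/-! ### Pointwise bounds of the second differences -/

section Bounds

variable [NeZero L] [NeZero N] {β μ θ Λ Λ' : ℝ}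

/-- `|θ| ≤ Λ/4` from `|βθ| ≤ π/4` and `π/β ≤ Λ`. [cite: BenfattoGiulianiMastropietro2006, §2.1 (2.3)] -/
theorem abs_shift_le_quarter (hβ : 0 < β) (hθ : |β * θ| ≤ Real.pi / 4) (hΛβ : Real.pi / β ≤ Λ) : |θ| ≤ Λ / 4 := by
  rw [abs_mul, abs_of_pos hβ] at hθ
  have h1 : |θ| ≤ Real.pi / (4 * β) := by
    rw [le_div_iff₀ (by positivity)]; linarith
  refine h1.trans ?_
  rw [div_le_div_iff₀ (by positivity) (by norm_num)]
  have := (div_le_iff₀ hβ).1 hΛβ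
  nlinarith

/-- **The second time difference of the padded slice symbol is at most `(βL²)⁻² (2π/β)² K βL²/Λ³`** (`K = 32B₂ + 144B₁ + 128`;
hypotheses: `0 < β`, `|βθ| ≤ π/4`, `π/β ≤ Λ ≤ Λ′ < π(2M-3)/β`, `2M ≤ N`, `2 ≤ M`). [cite: BenfattoGiulianiMastropietro2006, (2.36aa)] -/
theorem norm_fwdDiff_two_time_gridSymbol_le (hβ : 0 < β) (hθ : |β * θ| ≤ Real.pi / 4) (hΛ : 0 < Λ) (hΛβ : Real.pi / β ≤ Λ)
    (hΛΛ' : Λ ≤ Λ') (hM : Λ' < Real.pi * (2 * M - 3) / β) (hMN : 2 * M ≤ N) (hM2 : 2 ≤ M) {B₁ B₂ : ℝ}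
    (hB₁ : ∀ x, |deriv salmhoferCutoff x| ≤ B₁) (hB₂ : ∀ x, |deriv (deriv salmhoferCutoff) x| ≤ B₂)
    (σ : Fin 2) (q₀ : TorusSite 1 N) (qv : TorusSite 2 L) :
    ‖(fwdDiff (fun _ : Fin 1 => (1 : ZMod N)))^[2] (fun q => gridSymbol L M N β (shiftedSliceSymbol L M β μ θ Λ Λ') σ q qv) q₀‖ ≤
      ‖((1 / (β * (L : ℝ) ^ 2) : ℝ) : ℂ)‖ ^ 2 *
        ((2 * Real.pi / β) ^ 2 * ((32 * B₂ + 144 * B₁ + 128) * (β * (L : ℝ) ^ 2) / Λ ^ 3)) := by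
  have hθ' := abs_shift_le_quarter hβ hθ hΛβ
  rw [fwdDiff_two_time_gridSymbol_eq hβ hθ hΛ hΛΛ' hM hMN hM2 σ q₀ qv, norm_mul, norm_pow]
  refine mul_le_mul_of_nonneg_left ?_ (by positivity)
  exact Literature.Analysis.norm_second_difference_le (δ := 2 * Real.pi / β) (by positivity)
    (fun t _ => hasDerivAt_sliceSymbolFn hΛ hΛΛ' hθ' t) (fun t _ => hasDerivAt_sliceSymbolFnD1 hΛ hΛΛ' hθ' t)
    fun t _ => norm_sliceSymbolFnD2_le hΛ hΛΛ' hθ' (by positivity) hB₁ hB₂ t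

omit [NeZero N] in
/-- Along a momentum line the padded symbol is the restriction of `Φ`:
`G(q₀, q⃗ + m e_i) = (βL²)⁻² Φ(p_i + m·2π/L)` (`Λ′ < π(2M+1)/β`). [cite: BenfattoGiulianiMastropietro2006, §2.1 (2.3)] -/
theorem gridSymbol_shiftedSlice_add_smul_eq (hβ : 0 < β) (hθ : |β * θ| ≤ Real.pi / 4) (hΛ : 0 < Λ) (hΛΛ' : Λ ≤ Λ')
    (hM : Λ' < Real.pi * (2 * M + 1) / β) (σ : Fin 2) (q₀ : TorusSite 1 N) (qv : TorusSite 2 L) (i : Fin 2) (m : ℕ) :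
    gridSymbol L M N β (shiftedSliceSymbol L M β μ θ Λ Λ') σ q₀ (qv + m • (Pi.single i (1 : ZMod L) : TorusSite 2 L)) =
      ((1 / (β * (L : ℝ) ^ 2) : ℝ) : ℂ) ^ 2 *
        momentumSymbolFn (β * (L : ℝ) ^ 2) θ Λ Λ' (gridFreq M N β q₀) (nambuXi L μ qv + 2 * Real.cos (latticeMomentum L qv i))
          (latticeMomentum L qv i + m * (2 * Real.pi / L)) := by
  rw [gridSymbol_shiftedSlice_eq hβ hθ hΛ hΛΛ' hM, sliceSymbolFn_eq_sliceSymbolFnXi, momentumSymbolFn, nambuXi_add_smul_single]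

omit [NeZero N] in
/-- **The second space difference is the second difference of `Φ`** at step `2π/L`. [cite: BenfattoGiulianiMastropietro2006, (2.36aa)] -/
theorem fwdDiff_two_space_gridSymbol_eq (hβ : 0 < β) (hθ : |β * θ| ≤ Real.pi / 4) (hΛ : 0 < Λ) (hΛΛ' : Λ ≤ Λ')
    (hM : Λ' < Real.pi * (2 * M + 1) / β) (σ : Fin 2) (q₀ : TorusSite 1 N) (qv : TorusSite 2 L) (i : Fin 2) :
    (fwdDiff (Pi.single i (1 : ZMod L) : TorusSite 2 L))^[2] (gridSymbol L M N β (shiftedSliceSymbol L M β μ θ Λ Λ') σ q₀) qv =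
      ((1 / (β * (L : ℝ) ^ 2) : ℝ) : ℂ) ^ 2 *
        (momentumSymbolFn (β * (L : ℝ) ^ 2) θ Λ Λ' (gridFreq M N β q₀) (nambuXi L μ qv + 2 * Real.cos (latticeMomentum L qv i))
            (latticeMomentum L qv i + 2 * (2 * Real.pi / L)) -
          (2 : ℝ) • momentumSymbolFn (β * (L : ℝ) ^ 2) θ Λ Λ' (gridFreq M N β q₀)
            (nambuXi L μ qv + 2 * Real.cos (latticeMomentum L qv i)) (latticeMomentum L qv i + 2 * Real.pi / L) +
          momentumSymbolFn (β * (L : ℝ) ^ 2) θ Λ Λ' (gridFreq M N β q₀) (nambuXi L μ qv + 2 * Real.cos (latticeMomentum L qv i))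
            (latticeMomentum L qv i)) := by
  have hG := gridSymbol_shiftedSlice_add_smul_eq (μ := μ) hβ hθ hΛ hΛΛ' hM σ q₀ qv i
  rw [fwdDiff_iter_two_apply, hG 2, hG 1]
  have h0 := hG 0
  simp only [zero_smul, add_zero, Nat.cast_zero, zero_mul] at h0
  rw [h0]
  push_cast
  simp only [one_mul, zsmul_eq_mul, Int.cast_ofNat]
  rw [Complex.real_smul]
  push_cast
  ring

omit [NeZero N] in
/-- **The second space difference of the padded slice symbol is at most `(βL²)⁻² (2π/L)² K′ βL²/Λ³`** (`K′ = 128B₂ + 608B₁ + 544`;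
hypotheses: `0 < β`, `|βθ| ≤ π/4`, `π/β ≤ Λ ≤ Λ′ < π(2M+1)/β`, `Λ ≤ 1`). [cite: BenfattoGiulianiMastropietro2006, (2.36aa)] -/
theorem norm_fwdDiff_two_space_gridSymbol_le (hβ : 0 < β) (hθ : |β * θ| ≤ Real.pi / 4) (hΛ : 0 < Λ) (hΛβ : Real.pi / β ≤ Λ)
    (hΛ1 : Λ ≤ 1) (hΛΛ' : Λ ≤ Λ') (hM : Λ' < Real.pi * (2 * M + 1) / β) {B₁ B₂ : ℝ}
    (hB₁ : ∀ x, |deriv salmhoferCutoff x| ≤ B₁) (hB₂ : ∀ x, |deriv (deriv salmhoferCutoff) x| ≤ B₂)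
    (σ : Fin 2) (q₀ : TorusSite 1 N) (qv : TorusSite 2 L) (i : Fin 2) :
    ‖(fwdDiff (Pi.single i (1 : ZMod L) : TorusSite 2 L))^[2] (gridSymbol L M N β (shiftedSliceSymbol L M β μ θ Λ Λ') σ q₀) qv‖ ≤
      ‖((1 / (β * (L : ℝ) ^ 2) : ℝ) : ℂ)‖ ^ 2 *
        ((2 * Real.pi / L) ^ 2 * ((128 * B₂ + 608 * B₁ + 544) * (β * (L : ℝ) ^ 2) / Λ ^ 3)) := by
  have hθ' := abs_shift_le_quarter hβ hθ hΛβ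
  rw [fwdDiff_two_space_gridSymbol_eq hβ hθ hΛ hΛΛ' hM σ q₀ qv i, norm_mul, norm_pow]
  refine mul_le_mul_of_nonneg_left ?_ (by positivity)
  exact Literature.Analysis.norm_second_difference_le (δ := 2 * Real.pi / L) (by positivity)
    (fun t _ => hasDerivAt_momentumSymbolFn hΛ hΛΛ' hθ' t) (fun t _ => hasDerivAt_momentumSymbolFnD1 hΛ hΛΛ' hθ' t)
    fun t _ => norm_momentumSymbolFnD2_le hΛ hΛΛ' hΛ1 hθ' (by positivity) hB₁ hB₂ t

omit [NeZero N] in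
/-- **The padded symbol itself is at most `(βL²)⁻² · (8/3)βL²/Λ`.** [cite: BenfattoGiulianiMastropietro2006, §2.5 (2.50)] -/
theorem norm_gridSymbol_shiftedSlice_le (hβ : 0 < β) (hθ : |θ| ≤ Real.pi / (4 * β)) (hΛ : 0 < Λ) (hΛΛ' : Λ ≤ Λ')
    (σ : Fin 2) (q₀ : TorusSite 1 N) (qv : TorusSite 2 L) :
    ‖gridSymbol L M N β (shiftedSliceSymbol L M β μ θ Λ Λ') σ q₀ qv‖ ≤
      ‖((1 / (β * (L : ℝ) ^ 2) : ℝ) : ℂ)‖ ^ 2 * (8 / 3 * (β * (L : ℝ) ^ 2) / Λ) := by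
  unfold gridSymbol
  split_ifs with h
  · rw [norm_mul, norm_pow]
    exact mul_le_mul_of_nonneg_left (norm_sliceSymbol_le hβ μ hθ hΛ hΛΛ' _) (by positivity)
  · rw [norm_zero]; positivity

end Bounds

/-! ### Supports and sums of squares -/

section Sums

variable [NeZero L] [NeZero N] {β μ θ Λ Λ' : ℝ}

omit [NeZero L] [NeZero N] in
/-- The points of the time dual torus are determined by their coordinate `q₀ 0`. [cite: Salmhofer1999, §4.2.4 (4.63)] -/
theorem torusSite_one_ext {q q' : TorusSite 1 N} (h : q 0 = q' 0) : q = q' := by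
  funext l
  rw [Subsingleton.elim l 0]
  exact h

/-- **The frequency window**: `#{q₀ : val q₀ < 2M, |ω̃_{q₀}| ≤ Λ′} ≤ Λ′β/π + 3` (`0 < β`, `0 ≤ Λ′`).
[cite: BenfattoGiulianiMastropietro2006, §2.8 (2.80)] -/
theorem card_freqWindow_le (hβ : 0 < β) (hΛ' : 0 ≤ Λ') :
    ((((univ : Finset (TorusSite 1 N)).filter fun q₀ => (q₀ 0).val < 2 * M ∧ |gridFreq M N β q₀| ≤ Λ').card : ℕ) : ℝ) ≤
      Λ' * β / Real.pi + 3 := by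
  classical
  set T := (univ : Finset (TorusSite 1 N)).filter fun q₀ => (q₀ 0).val < 2 * M ∧ |gridFreq M N β q₀| ≤ Λ' with hT
  have hinj : Set.InjOn (fun q₀ : TorusSite 1 N => ((q₀ 0).val : ℤ) - M) T := by
    intro q _ q' _ h
    have h1 : (q 0).val = (q' 0).val := by
      have := h; simp only [sub_left_inj, Nat.cast_inj] at this; exact this
    exact torusSite_one_ext (ZMod.val_injective _ h1)
  rw [← card_image_of_injOn hinj]
  refine card_fermiMatsubara_le hβ hΛ' _ fun m hm => ?_
  obtain ⟨q₀, hq₀, rfl⟩ := mem_image.1 hm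
  have h2 := (mem_filter.1 hq₀).2.2
  rw [fermiMatsubara]
  convert h2 using 2
  rw [gridFreq]
  push_cast
  ring

/-- **Where the padded symbol is nonzero**: `val q₀ < 2M`, `|ω̃_{q₀}| ≤ Λ′` and `|ε(q⃗) - μ| < Λ′` (`0 < Λ ≤ Λ′`).
[cite: BenfattoGiulianiMastropietro2006, §2.8 (2.80)] -/
theorem gridSymbol_ne_zero_mem (hΛ : 0 < Λ) (hΛΛ' : Λ ≤ Λ') (σ : Fin 2) {q₀ : TorusSite 1 N} {qv : TorusSite 2 L}
    (h : gridSymbol L M N β (shiftedSliceSymbol L M β μ θ Λ Λ') σ q₀ qv ≠ 0) :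
    q₀ ∈ (univ : Finset (TorusSite 1 N)).filter (fun q₀ => (q₀ 0).val < 2 * M ∧ |gridFreq M N β q₀| ≤ Λ') ∧
      qv ∈ (univ : Finset (TorusSite 2 L)).filter fun k => |torusBand L k - μ| < Λ' := by
  classical
  unfold gridSymbol at h
  split_ifs at h with hv
  · have hp : shiftedSliceSymbol L M β μ θ Λ Λ' ((⟨(q₀ 0).val, hv⟩, qv), σ) ≠ 0 := fun h0 => h (by rw [h0, mul_zero])
    have hmem := mem_shell_of_sliceSymbol_ne_zero (β := β) μ θ hΛ hΛΛ' (⟨(q₀ 0).val, hv⟩, qv) σ hp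
    rw [mem_filter] at hmem
    refine ⟨mem_filter.2 ⟨mem_univ _, hv, ?_⟩, mem_filter.2 ⟨mem_univ _, hmem.2.2⟩⟩
    rw [← matsubaraFreq_eq_gridFreq β q₀ hv]
    exact hmem.2.1
  · exact absurd rfl h

/-- **The `ℓ²` norm of the padded slice symbol**:
`Σ_q ‖G(q)‖² ≤ (Λ′β/π + 3) · 4L(Λ′L/(2π√(d₀/8)) + 1) · ((βL²)⁻² (8/3)βL²/Λ)²`. [cite: BenfattoGiulianiMastropietro2006, §2.8 (2.80)-(2.81)] -/
theorem sum_norm_sq_gridSymbol_shiftedSlice_le (hβ : 0 < β) {d₀ : ℝ} (hμ4 : d₀ ≤ μ + 4) (hμ0 : d₀ ≤ -μ)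
    (hθ : |θ| ≤ Real.pi / (4 * β)) (hΛ : 0 < Λ) (hΛΛ' : Λ ≤ Λ') (hΛ'd : Λ' ≤ d₀ / 2) (σ : Fin 2) :
    ∑ q₀ : TorusSite 1 N, ∑ qv : TorusSite 2 L, ‖gridSymbol L M N β (shiftedSliceSymbol L M β μ θ Λ Λ') σ q₀ qv‖ ^ 2 ≤
      (Λ' * β / Real.pi + 3) * (4 * (L * (Λ' * L / (2 * Real.pi * Real.sqrt (d₀ / 8)) + 1))) *
        (‖((1 / (β * (L : ℝ) ^ 2) : ℝ) : ℂ)‖ ^ 2 * (8 / 3 * (β * (L : ℝ) ^ 2) / Λ)) ^ 2 := by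
  classical
  have hΛ' : 0 < Λ' := hΛ.trans_le hΛΛ'
  refine (sum_sum_norm_sq_le_of_support _ _ _ (fun q₀ qv h => gridSymbol_ne_zero_mem hΛ hΛΛ' σ h)
    fun q₀ qv => norm_gridSymbol_shiftedSlice_le hβ hθ hΛ hΛΛ' σ q₀ qv).trans ?_
  refine mul_le_mul_of_nonneg_right (mul_le_mul (card_freqWindow_le hβ hΛ'.le) (card_torusShell_le hμ4 hμ0 hΛ' hΛ'd)
    (Nat.cast_nonneg _) (by positivity)) (by positivity)

/-- **The `ℓ²` norm of the second time differences**: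
`Σ_{q₀,q⃗} ‖(Δ_u)² G(·,q⃗)(q₀)‖² ≤ 3(Λ′β/π + 3) · 4L(Λ′L/(2π√(d₀/8)) + 1) · ((βL²)⁻² (2π/β)² K βL²/Λ³)²`.
[cite: BenfattoGiulianiMastropietro2006, Lemma 2.2 (2.36aa)] -/
theorem sum_norm_sq_fwdDiff_two_time_le (hβ : 0 < β) {d₀ : ℝ} (hμ4 : d₀ ≤ μ + 4) (hμ0 : d₀ ≤ -μ)
    (hθ : |β * θ| ≤ Real.pi / 4) (hΛ : 0 < Λ) (hΛβ : Real.pi / β ≤ Λ) (hΛΛ' : Λ ≤ Λ') (hΛ'd : Λ' ≤ d₀ / 2)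
    (hM : Λ' < Real.pi * (2 * M - 3) / β) (hMN : 2 * M ≤ N) (hM2 : 2 ≤ M) {B₁ B₂ : ℝ}
    (hB₁ : ∀ x, |deriv salmhoferCutoff x| ≤ B₁) (hB₂ : ∀ x, |deriv (deriv salmhoferCutoff) x| ≤ B₂) (σ : Fin 2) :
    ∑ q₀ : TorusSite 1 N, ∑ qv : TorusSite 2 L,
        ‖(fwdDiff (fun _ : Fin 1 => (1 : ZMod N)))^[2]
          (fun q => gridSymbol L M N β (shiftedSliceSymbol L M β μ θ Λ Λ') σ q qv) q₀‖ ^ 2 ≤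
      3 * (Λ' * β / Real.pi + 3) * (4 * (L * (Λ' * L / (2 * Real.pi * Real.sqrt (d₀ / 8)) + 1))) *
        (‖((1 / (β * (L : ℝ) ^ 2) : ℝ) : ℂ)‖ ^ 2 *
          ((2 * Real.pi / β) ^ 2 * ((32 * B₂ + 144 * B₁ + 128) * (β * (L : ℝ) ^ 2) / Λ ^ 3))) ^ 2 := by
  classical
  have hΛ' : 0 < Λ' := hΛ.trans_le hΛΛ'
  set u : TorusSite 1 N := fun _ => (1 : ZMod N) with hu
  set Tω := (univ : Finset (TorusSite 1 N)).filter fun q₀ => (q₀ 0).val < 2 * M ∧ |gridFreq M N β q₀| ≤ Λ' with hTω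
  set Sξ := (univ : Finset (TorusSite 2 L)).filter fun k => |torusBand L k - μ| < Λ' with hSξ
  set T3 := (range 3).biUnion fun j => Tω.image fun q => q - j • u with hT3
  have hsupp : ∀ (q₀ : TorusSite 1 N) (qv : TorusSite 2 L),
      (fwdDiff u)^[2] (fun q => gridSymbol L M N β (shiftedSliceSymbol L M β μ θ Λ Λ') σ q qv) q₀ ≠ 0 →
        q₀ ∈ T3 ∧ qv ∈ Sξ := by
    intro q₀ qv h
    obtain ⟨j, hj, hne⟩ := exists_ne_zero_of_fwdDiff_iter_two_ne_zero u _ q₀ h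
    obtain ⟨hq, hk⟩ := gridSymbol_ne_zero_mem hΛ hΛΛ' σ hne
    refine ⟨?_, hk⟩
    rw [hT3, mem_biUnion]
    exact ⟨j, mem_range.2 hj, mem_image.2 ⟨q₀ + j • u, hq, by simp⟩⟩
  have hT3card : (T3.card : ℝ) ≤ 3 * (Λ' * β / Real.pi + 3) := by
    have h1 : T3.card ≤ 3 * Tω.card := by
      refine (card_biUnion_le).trans ?_
      calc ∑ j ∈ range 3, (Tω.image fun q => q - j • u).card ≤ ∑ _j ∈ range 3, Tω.card :=
            sum_le_sum fun j _ => card_image_le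
        _ = 3 * Tω.card := by rw [sum_const, card_range, smul_eq_mul]
    have h2 : (T3.card : ℝ) ≤ 3 * (Tω.card : ℝ) := by exact_mod_cast h1
    exact h2.trans (mul_le_mul_of_nonneg_left (card_freqWindow_le hβ hΛ'.le) (by norm_num))
  refine (sum_sum_norm_sq_le_of_support _ T3 Sξ hsupp fun q₀ qv =>
    norm_fwdDiff_two_time_gridSymbol_le hβ hθ hΛ hΛβ hΛΛ' hM hMN hM2 hB₁ hB₂ σ q₀ qv).trans ?_
  exact mul_le_mul_of_nonneg_right (mul_le_mul hT3card (card_torusShell_le hμ4 hμ0 hΛ' hΛ'd) (Nat.cast_nonneg _)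
    (by positivity)) (by positivity)

/-- **The `ℓ²` norm of the second space differences** (direction `i`):
`Σ_{q₀,q⃗} ‖(Δ_{e_i})² G(q₀,·)(q⃗)‖² ≤ (Λ′β/π + 3) · 3·4L(Λ′L/(2π√(d₀/8)) + 1) · ((βL²)⁻² (2π/L)² K′ βL²/Λ³)²`.
[cite: BenfattoGiulianiMastropietro2006, Lemma 2.2 (2.36aa)] -/
theorem sum_norm_sq_fwdDiff_two_space_le (hβ : 0 < β) {d₀ : ℝ} (hμ4 : d₀ ≤ μ + 4) (hμ0 : d₀ ≤ -μ)
    (hθ : |β * θ| ≤ Real.pi / 4) (hΛ : 0 < Λ) (hΛβ : Real.pi / β ≤ Λ) (hΛ1 : Λ ≤ 1) (hΛΛ' : Λ ≤ Λ') (hΛ'd : Λ' ≤ d₀ / 2)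
    (hM : Λ' < Real.pi * (2 * M + 1) / β) {B₁ B₂ : ℝ}
    (hB₁ : ∀ x, |deriv salmhoferCutoff x| ≤ B₁) (hB₂ : ∀ x, |deriv (deriv salmhoferCutoff) x| ≤ B₂) (σ : Fin 2) (i : Fin 2) :
    ∑ q₀ : TorusSite 1 N, ∑ qv : TorusSite 2 L,
        ‖(fwdDiff (Pi.single i (1 : ZMod L) : TorusSite 2 L))^[2]
          (gridSymbol L M N β (shiftedSliceSymbol L M β μ θ Λ Λ') σ q₀) qv‖ ^ 2 ≤
      (Λ' * β / Real.pi + 3) * (3 * (4 * (L * (Λ' * L / (2 * Real.pi * Real.sqrt (d₀ / 8)) + 1)))) *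
        (‖((1 / (β * (L : ℝ) ^ 2) : ℝ) : ℂ)‖ ^ 2 *
          ((2 * Real.pi / L) ^ 2 * ((128 * B₂ + 608 * B₁ + 544) * (β * (L : ℝ) ^ 2) / Λ ^ 3))) ^ 2 := by
  classical
  have hΛ' : 0 < Λ' := hΛ.trans_le hΛΛ'
  set e : TorusSite 2 L := Pi.single i (1 : ZMod L) with he
  set Tω := (univ : Finset (TorusSite 1 N)).filter fun q₀ => (q₀ 0).val < 2 * M ∧ |gridFreq M N β q₀| ≤ Λ' with hTω
  set Sξ := (univ : Finset (TorusSite 2 L)).filter fun k => |torusBand L k - μ| < Λ' with hSξ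
  set S3 := (range 3).biUnion fun j => Sξ.image fun k => k - j • e with hS3
  have hsupp : ∀ (q₀ : TorusSite 1 N) (qv : TorusSite 2 L),
      (fwdDiff e)^[2] (gridSymbol L M N β (shiftedSliceSymbol L M β μ θ Λ Λ') σ q₀) qv ≠ 0 → q₀ ∈ Tω ∧ qv ∈ S3 := by
    intro q₀ qv h
    obtain ⟨j, hj, hne⟩ := exists_ne_zero_of_fwdDiff_iter_two_ne_zero e _ qv h
    obtain ⟨hq, hk⟩ := gridSymbol_ne_zero_mem hΛ hΛΛ' σ hne
    refine ⟨hq, ?_⟩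
    rw [hS3, mem_biUnion]
    exact ⟨j, mem_range.2 hj, mem_image.2 ⟨qv + j • e, hk, by simp⟩⟩
  have hS3card : (S3.card : ℝ) ≤ 3 * (4 * (L * (Λ' * L / (2 * Real.pi * Real.sqrt (d₀ / 8)) + 1))) := by
    have h1 : S3.card ≤ 3 * Sξ.card := by
      refine (card_biUnion_le).trans ?_
      calc ∑ j ∈ range 3, (Sξ.image fun k => k - j • e).card ≤ ∑ _j ∈ range 3, Sξ.card :=
            sum_le_sum fun j _ => card_image_le
        _ = 3 * Sξ.card := by rw [sum_const, card_range, smul_eq_mul]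
    have h2 : (S3.card : ℝ) ≤ 3 * (Sξ.card : ℝ) := by exact_mod_cast h1
    exact h2.trans (mul_le_mul_of_nonneg_left (card_torusShell_le hμ4 hμ0 hΛ' hΛ'd) (by norm_num))
  refine (sum_sum_norm_sq_le_of_support _ Tω S3 hsupp fun q₀ qv =>
    norm_fwdDiff_two_space_gridSymbol_le hβ hθ hΛ hΛβ hΛ1 hΛΛ' hM hB₁ hB₂ σ q₀ qv i).trans ?_
  exact mul_le_mul_of_nonneg_right (mul_le_mul (card_freqWindow_le hβ hΛ'.le) hS3card (Nat.cast_nonneg _)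
    (by positivity)) (by positivity)

end Sums

end Literature.MathematicalPhysics.QuantumLattice

end
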